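import Summits.ValiantsHypothesis.ValiantsHypothesis.Theses.LacunarySymmetroid
import Summits.ValiantsHypothesis.ValiantsHypothesis.Theorems.LacunarySymmetroidMatrixDescartesCensusDefs
import Summits.ValiantsHypothesis.ValiantsHypothesis.Theorems.LacunarySymmetroidMatrixDescartesStubArith4
import Summits.ValiantsHypothesis.ValiantsHypothesis.Theorems.LacunarySymmetroidMatrixDescartesStubNegRoots
import Mathlib
import Literature.Computability.AlgebraicComplexity.TavenasHutchinsonFamily
import Literature.Computability.AlgebraicComplexity.TavenasVnWitness
import Summits.ValiantsHypothesis.ValiantsHypothesis.Theorems.LacunarySymmetroidThetaWitness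
import Summits.ValiantsHypothesis.ValiantsHypothesis.Theorems.LacunarySymmetroidPencilTransfer

/-!
# Tower door — COMPLETE, self-contained (TowerDoor.lean + TowerDoorWitness.lean + final joint in one module)

Published because the farm had not yet built the two Cruxes modules for cross-import.  Content = `TowerDoor.lean`
(@6b783059033a: the door `closes_tower`, `valiant_of_towerB : TowerB → PencilTransfer → TowerThetaWitness → VH`) followed by
`TowerDoorWitness.lean` (@ce824d8b8b4b: `towerThetaWitness_holds : TowerThetaWitness`) and the joint
`valiant_of_towerB_alone : TowerB → ValiantsHypothesis` (PencilTransfer from the tree's `pencilTransfer_proof`).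
Namespace `…Cruxes.MatrixDescartes.TowerDoorComplete` (to avoid clashes with the two part-files).  VP ≠ VNP is NOT proved:
`TowerB` (= Conjecture B on tower supports, head of LINE (B) `Cruxes/WeakLifting/Lines/tower_graft.lean`) is open.
val-idea-22 g7.
-/

/-!
# Sketch — «tower door» (val-idea-22 g7, crux idea on `MatrixDescartes` = stmt-ValiantsHypothesis-18050)

DOOR SUPPORT FREEDOM.  The route's deciding theorem `LacunarySymmetroid.closes` consumes `MatrixDescartes`
only on the Kronecker supports of the VNP witness, and those WEIGHTS are free.  Re-weighting the Tavenas /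
Hutchinson witness along a hyper-geometric Kronecker curve `y_i ↦ X^{G_n^i}`, `G_n = 2^n`, makes every
transferred pencil support `(0, 1, G_n, …, G_n^{n-1})` an `m`-TOWER (`m·d_l < d_{l'}` for `l < l'`) for every
size `m ≤ 2^{(log n + c)^c} < 2^n = G_n` in the quasi-polynomial window.  Hence the crux is needed only on tower
supports (`TowerMatrixDescartes`), and Conjecture B on towers in the all-real-roots currency
(`TowerRealRootLaw`; = the tree's `TowerB` of LINE (B) `Cruxes/WeakLifting/Lines/tower_graft.lean` up to the
reflection `X ↦ −X` and the root `0`) already decides the summit together with the CLOSED item `PencilTransfer`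
and the new witness item `TowerThetaWitness` (routine variant of the CLOSED `ThetaWitness`).

Kernel content of this file (no `sorry`): the defs, `isTower_cons_pow`, the bridge
`towerMatrixDescartes_of_towerRealRootLaw` (verbatim arithmetic of `Census.matrixDescartes_of_kPlusLogSqLaw`)
and the deciding composition `closes_tower` (verbatim arithmetic of `LacunarySymmetroid.closes` + the tower
discharge).  `TowerThetaWitness` itself is NOT proved here (item-sized, L: the tree's `thetaWitness_proof`
machinery with Gaussian-in-value weights `2^{-2 k²}`; see the card).  VP ≠ VNP is NOT proved by any of this.
-/

set_option linter.dupNamespace false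

open Polynomial
open scoped BigOperators

namespace Summit.ValiantsHypothesis.ValiantsHypothesis.Cruxes.MatrixDescartes.TowerDoorComplete

open Summit.ValiantsHypothesis.ValiantsHypothesis.Theses.LacunarySymmetroid
  (MatrixDescartes PencilTransfer ThetaWitness)
open Summit.ValiantsHypothesis.ValiantsHypothesis.Theorems.LacunarySymmetroidMatrixDescartes

-- `PosRootLawOn` (census currency, positive roots) is `…Theorems.LacunarySymmetroidMatrixDescartes.PosRootLawOn` (CensusDefs).

/-- Tower support relative to the size `m` — VERBATIM the `IsTower` of LINE (B)
(`Cruxes/WeakLifting/Lines/tower_graft.lean`, namespace `…Cruxes.WeakLifting.TowerGraftLine`), inlined so that this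
file does not import a `Cruxes/` module (farm snapshot coherence): every letter exponent exceeds `m` times every
earlier one. -/
def IsTower (m : ℕ) {K : ℕ} (d : Fin K → ℕ) : Prop := ∀ l l' : Fin K, l < l' → m * d l < d l'

/-- VERBATIM the `TowerB` of LINE (B) (same file/namespace; definitionally equal): Conjecture B on tower supports in
the census currency `PosRootLawOn` (positive roots). LINE (B) proves `towerB_of_graftLaw : TowerGraftLaw → TowerB`
(from the registered stub S5 `stub_oneLetterGraftLaw`) and, at rev 9, `towerB_of_sizeDoublingPoly : TowerB` from S4f
`stub_sizeDoublingPoly` + the CLOSED S4h `stub_sizeMono`. -/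
def TowerB : Prop :=
  ∃ C : ℕ, ∀ (m K : ℕ) (d : Fin K → ℕ), IsTower m d → PosRootLawOn m K (2 ^ (C * (K + Nat.log 2 m ^ 2))) d

/-- **D1 — Conjecture B on tower supports, all-real-roots currency** (`TowerB` of LINE (B) up to `X ↦ −X` and the
root `0`): `∃ C, ∀ m K`, every symmetric `(m,K)` pencil on an `m`-tower support has `≤ 2^{C (K + log₂² m)}`
distinct real determinant roots. -/
def TowerRealRootLaw : Prop :=
  ∃ C : ℕ, ∀ (m K : ℕ) (d : Fin K → ℕ) (S : Fin K → Matrix (Fin m) (Fin m) ℝ), IsTower m d →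
    (∀ l, (S l).IsSymm) →
      (Matrix.det (∑ l, ((Polynomial.X : Polynomial ℝ) ^ d l) • (S l).map Polynomial.C)
        ).roots.toFinset.card ≤ 2 ^ (C * (K + Nat.log 2 m ^ 2))

/-- **D2 — the crux `MatrixDescartes` restricted to tower supports** (verbatim, one hypothesis added). -/
def TowerMatrixDescartes : Prop :=
  ∀ c q : ℕ, 0 < q → ∃ K₀ : ℕ, ∀ K m : ℕ, K₀ ≤ K → m ≤ 2 ^ ((Nat.log 2 K + c) ^ c) →
    ∀ (d : Fin K → ℕ) (S : Fin K → Matrix (Fin m) (Fin m) ℝ), IsTower m d → (∀ l, (S l).IsSymm) →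
      (Matrix.det (∑ l, ((Polynomial.X : Polynomial ℝ) ^ d l) • (S l).map Polynomial.C)
        ).roots.toFinset.card ^ q ≤ 2 ^ (K * Nat.log 2 K)

/-- **D3 — the tower-weighted witness**: a VNP family `Θ_n` whose restriction to the hyper-geometric Kronecker
curve `y_i ↦ X^{(2^n)^i}` has `≥ 2^{n ⌊log₂ n⌋} − 1` distinct real roots (eventually in `n`). -/
def TowerThetaWitness : Prop :=
  ∃ Θ : ∀ n : ℕ, MvPolynomial (Fin n) ℝ,
    Literature.Computability.AlgebraicComplexity.IsVNPFamily
        (fun n => MvPolynomial.map (algebraMap ℝ ℂ) (Θ n)) ∧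
      ∃ n₀ : ℕ, ∀ n : ℕ, n₀ ≤ n →
        2 ^ (n * Nat.log 2 n) ≤
          (MvPolynomial.aeval (fun i : Fin n => (Polynomial.X : Polynomial ℝ) ^ (2 ^ n) ^ (i : ℕ))
            (Θ n)).roots.toFinset.card + 1

/-- The transferred support `(0, G^0, G^1, …, G^{n-1})` is an `m`-tower as soon as `m < G`. -/
theorem isTower_cons_pow {m G n : ℕ} (hmG : m < G) :
    IsTower m (Fin.cons (α := fun _ => ℕ) (0 : ℕ) (fun i : Fin n => G ^ (i : ℕ))) := by
  intro l l' hll'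
  have hG1 : 1 ≤ G := by omega
  induction l using Fin.cases with
  | zero =>
    induction l' using Fin.cases with
    | zero => exact absurd hll' (lt_irrefl _)
    | succ j => simp only [Fin.cons_zero, Fin.cons_succ, mul_zero]; exact Nat.one_le_pow _ _ hG1
  | succ i =>
    induction l' using Fin.cases with
    | zero => exact absurd hll' (Fin.not_lt_zero _)
    | succ j =>
      simp only [Fin.cons_succ]
      have hij : (i : ℕ) < j := by
        have := Fin.succ_lt_succ_iff.1 hll'
        exact this
      calc m * G ^ (i : ℕ) < G * G ^ (i : ℕ) := Nat.mul_lt_mul_of_pos_right hmG (Nat.one_le_pow _ _ hG1)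
        _ = G ^ ((i : ℕ) + 1) := (pow_succ' _ _).symm
        _ ≤ G ^ (j : ℕ) := Nat.pow_le_pow_right hG1 hij

/-- The quasi-polynomial window is eventually below `2^n`: `(⌊log₂ n⌋ + c)^c < n` for all large `n`. -/
theorem window_lt (c : ℕ) : ∃ n₁ : ℕ, ∀ n : ℕ, n₁ ≤ n → (Nat.log 2 n + c) ^ c < n := by
  obtain ⟨L₁, hL₁⟩ := StubArith4.poly_le_two_pow c 2
  refine ⟨2 ^ L₁, fun n hn => ?_⟩
  have hn0 : n ≠ 0 := by have := Nat.one_le_two_pow (n := L₁); omega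
  have hL : L₁ ≤ Nat.log 2 n := Nat.le_log_of_pow_le one_lt_two hn
  have h1 : 2 * (Nat.log 2 n + c) ^ c ≤ 2 ^ Nat.log 2 n := hL₁ _ hL
  have h2 : 2 ^ Nat.log 2 n ≤ n := Nat.pow_log_le_self 2 hn0
  omega

/-- **Bridge** `TowerRealRootLaw → TowerMatrixDescartes` (the arithmetic of
`Census.matrixDescartes_of_kPlusLogSqLaw`, with the tower hypothesis threaded through). -/
theorem towerMatrixDescartes_of_towerRealRootLaw (h : TowerRealRootLaw) : TowerMatrixDescartes := by
  obtain ⟨C, hC⟩ := h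
  intro c q _hq
  obtain ⟨K₁, hK₁⟩ := StubArith4.exp_le (2 * c) (2 * q * C)
  refine ⟨max K₁ (2 ^ (2 * q * C)), fun K m hK hm d S hT hS => ?_⟩
  have hK1 : K₁ ≤ K := le_of_max_le_left hK
  have hK2 : 2 ^ (2 * q * C) ≤ K := le_of_max_le_right hK
  have hL : 2 * q * C ≤ Nat.log 2 K := Nat.le_log_of_pow_le one_lt_two hK2
  have hlogm : Nat.log 2 m ≤ (Nat.log 2 K + c) ^ c :=
    calc Nat.log 2 m ≤ Nat.log 2 (2 ^ ((Nat.log 2 K + c) ^ c)) := Nat.log_mono_right hm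
      _ = (Nat.log 2 K + c) ^ c := Nat.log_pow one_lt_two _
  have hsq : Nat.log 2 m ^ 2 ≤ (Nat.log 2 K + 2 * c) ^ (2 * c) :=
    calc Nat.log 2 m ^ 2 ≤ ((Nat.log 2 K + c) ^ c) ^ 2 := Nat.pow_le_pow_left hlogm 2
      _ = (Nat.log 2 K + c) ^ (2 * c) := by rw [← pow_mul, mul_comm]
      _ ≤ (Nat.log 2 K + 2 * c) ^ (2 * c) := Nat.pow_le_pow_left (by omega) _
  have hZ := hC m K d S hT hS
  have h1 : 2 * q * C * (Nat.log 2 K + 2 * c) ^ (2 * c) ≤ K * Nat.log 2 K := hK₁ K hK1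
  have h2 : 2 * q * C * K ≤ K * Nat.log 2 K :=
    calc 2 * q * C * K = K * (2 * q * C) := by ring
      _ ≤ K * Nat.log 2 K := Nat.mul_le_mul_left K hL
  have h3 : q * C * Nat.log 2 m ^ 2 ≤ q * C * (Nat.log 2 K + 2 * c) ^ (2 * c) :=
    Nat.mul_le_mul_left _ hsq
  have hexp : q * (C * (K + Nat.log 2 m ^ 2)) ≤ K * Nat.log 2 K := by
    have e1 : q * (C * (K + Nat.log 2 m ^ 2)) = q * C * K + q * C * Nat.log 2 m ^ 2 := by ring
    have e2 : 2 * q * C * (Nat.log 2 K + 2 * c) ^ (2 * c) =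
        2 * (q * C * (Nat.log 2 K + 2 * c) ^ (2 * c)) := by ring
    have e3 : 2 * q * C * K = 2 * (q * C * K) := by ring
    rw [e2] at h1
    rw [e3] at h2
    omega
  calc (Matrix.det (∑ l, ((Polynomial.X : Polynomial ℝ) ^ d l) • (S l).map Polynomial.C)
          ).roots.toFinset.card ^ q
      ≤ (2 ^ (C * (K + Nat.log 2 m ^ 2))) ^ q := Nat.pow_le_pow_left hZ q
    _ = 2 ^ (q * (C * (K + Nat.log 2 m ^ 2))) := by rw [← pow_mul, mul_comm]
    _ ≤ 2 ^ (K * Nat.log 2 K) := Nat.pow_le_pow_right (by norm_num) hexp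

/-- The crux as printed gives its tower restriction (restriction). -/
theorem towerMatrixDescartes_of_matrixDescartes (h : MatrixDescartes) : TowerMatrixDescartes := by
  intro c q hq
  obtain ⟨K₀, hK⟩ := h c q hq
  exact ⟨K₀, fun K m hK0 hm d S _ hS => hK K m hK0 hm d S hS⟩

/-- **The tower door decides the summit**: `TowerMatrixDescartes → PencilTransfer → TowerThetaWitness → VP ≠ VNP`
(the arithmetic of `LacunarySymmetroid.closes`; new step: the transferred support `Fin.cons 0 (2^n)^i` is an
`m`-tower because `m ≤ 2^{(log n + c)^c} < 2^n`, `window_lt` + `isTower_cons_pow`). -/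
theorem closes_tower (hMDR : TowerMatrixDescartes) (hT : PencilTransfer) (hW : TowerThetaWitness) :
    _root_.ValiantsHypothesis := by
  show Literature.Computability.AlgebraicComplexity.VP ℂ ≠ Literature.Computability.AlgebraicComplexity.VNP ℂ
  intro hEq
  obtain ⟨Θ, hVNP, n₀, hroots⟩ := hW
  set d : (n : ℕ) → Fin n → ℕ := fun n i => (2 ^ n) ^ (i : ℕ) with hd
  have hVP : Literature.Computability.AlgebraicComplexity.IsVPFamily
      (fun n => MvPolynomial.map (algebraMap ℝ ℂ) (Θ n)) := by
    have hmem := (Literature.Computability.AlgebraicComplexity.mem_VNP_ofFintype_iff_holds _).2 hVNP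
    rw [← hEq] at hmem
    exact (Literature.Computability.AlgebraicComplexity.mem_VP_ofFintype_iff_holds _).1 hmem
  obtain ⟨c, hc⟩ := hT (fun n => n) Θ hVP d
  obtain ⟨K₀, hK⟩ := hMDR c 4 (by norm_num)
  obtain ⟨n₁, hn₁⟩ := window_lt c
  obtain ⟨n, hn₀, hnK, hn4, hn1⟩ : ∃ n, n₀ ≤ n ∧ K₀ ≤ n ∧ 4 ≤ n ∧ n₁ ≤ n :=
    ⟨n₀ + K₀ + 4 + n₁, by omega, by omega, by omega, by omega⟩
  obtain ⟨m, hm, S, hS, hroot⟩ := hc n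
  set Z := (MvPolynomial.aeval (fun i => (Polynomial.X : Polynomial ℝ) ^ d n i) (Θ n)).roots.toFinset.card
    with hZ
  have hm' : m ≤ 2 ^ ((Nat.log 2 (n + 1) + c) ^ c) :=
    hm.trans (Nat.pow_le_pow_right (by norm_num)
      (Nat.pow_le_pow_left (Nat.add_le_add_right (Nat.log_mono_right (Nat.le_succ n)) c) c))
  -- NEW STEP: the transferred support is an `m`-tower
  have hmG : m < 2 ^ n :=
    lt_of_le_of_lt hm (Nat.pow_lt_pow_right (by norm_num) (hn₁ n hn1))
  have hTow : IsTower m (Fin.cons (α := fun _ => ℕ) (0 : ℕ) (d n)) := isTower_cons_pow hmG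
  have h1 := hK (n + 1) m (by omega) hm' (Fin.cons (α := fun _ => ℕ) (0 : ℕ) (d n)) S hTow hS
  rw [hroot] at h1
  have h2 : 2 ^ (n * Nat.log 2 n) ≤ Z + 1 := hroots n hn₀
  set L := Nat.log 2 n with hL
  have hL2 : 2 ≤ L := by
    rw [hL]
    calc 2 = Nat.log 2 4 := by decide
      _ ≤ Nat.log 2 n := Nat.log_mono_right hn4
  have hLn : L ≤ n := by rw [hL]; exact Nat.log_le_self 2 n
  have hL' : Nat.log 2 (n + 1) ≤ L + 1 := by
    rw [hL]
    calc Nat.log 2 (n + 1) ≤ Nat.log 2 (n * 2) := Nat.log_mono_right (by omega)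
      _ = Nat.log 2 n + 1 := Nat.log_mul_base (by norm_num) (by omega)
  have h3 : Z ^ 4 ≤ 2 ^ ((n + 1) * (L + 1)) :=
    h1.trans (Nat.pow_le_pow_right (by norm_num) (Nat.mul_le_mul_left _ hL'))
  have hnL : 1 ≤ n * L := by nlinarith
  have h4 : 2 ^ (n * L - 1) ≤ Z := by
    have e : 2 ^ (n * L) = 2 * 2 ^ (n * L - 1) := by
      rw [← Nat.pow_succ']
      congr 1
      omega
    have h2' := h2
    rw [e] at h2'
    have : 1 ≤ 2 ^ (n * L - 1) := Nat.one_le_two_pow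
    omega
  have h5 : 2 ^ (4 * (n * L - 1)) ≤ Z ^ 4 := by
    rw [pow_mul']
    exact Nat.pow_le_pow_left h4 4
  have h6 : 4 * (n * L - 1) ≤ (n + 1) * (L + 1) :=
    (Nat.pow_le_pow_iff_right (by norm_num)).1 (h5.trans h3)
  have h7 : 6 * n ≤ 3 * (n * L) := by nlinarith
  have h6' : 4 * (n * L - 1) ≤ n * L + n + L + 1 := by
    have e : (n + 1) * (L + 1) = n * L + n + L + 1 := by ring
    rw [e] at h6
    exact h6
  generalize hP : n * L = P at h6' h7 hnL
  omega

/-- **D2♯ — the sharpest door: ONE explicit support per `K`.**  The crux demanded only on the hyper-geometric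
supports `(0, 1, 2^n, 2^{2n}, …, 2^{n(n-1)})` (`K = n + 1` letters) — literally the only supports `closes_tower`
feeds to the law (stated with the window measured at `n`, as `PencilTransfer` delivers it). -/
def HyperGPMatrixDescartes : Prop :=
  ∀ c q : ℕ, 0 < q → ∃ n₀ : ℕ, ∀ n m : ℕ, n₀ ≤ n → m ≤ 2 ^ ((Nat.log 2 n + c) ^ c) →
    ∀ (S : Fin (n + 1) → Matrix (Fin m) (Fin m) ℝ), (∀ l, (S l).IsSymm) →
      (Matrix.det (∑ l, ((Polynomial.X : Polynomial ℝ) ^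
          (Fin.cons (α := fun _ => ℕ) (0 : ℕ) (fun i : Fin n => (2 ^ n) ^ (i : ℕ)) l)) • (S l).map Polynomial.C)
        ).roots.toFinset.card ^ q ≤ 2 ^ ((n + 1) * Nat.log 2 (n + 1))

/-- `TowerMatrixDescartes → HyperGPMatrixDescartes` (the hyper-GP support is an `m`-tower throughout the window). -/
theorem hyperGP_of_towerMatrixDescartes (h : TowerMatrixDescartes) : HyperGPMatrixDescartes := by
  intro c q hq
  obtain ⟨K₀, hK⟩ := h c q hq
  obtain ⟨n₁, hn₁⟩ := window_lt c
  refine ⟨K₀ + n₁, fun n m hn hm S hS => ?_⟩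
  have hmG : m < 2 ^ n := lt_of_le_of_lt hm (Nat.pow_lt_pow_right (by norm_num) (hn₁ n (by omega)))
  have hm' : m ≤ 2 ^ ((Nat.log 2 (n + 1) + c) ^ c) :=
    hm.trans (Nat.pow_le_pow_right (by norm_num)
      (Nat.pow_le_pow_left (Nat.add_le_add_right (Nat.log_mono_right (Nat.le_succ n)) c) c))
  exact hK (n + 1) m (by omega) hm' _ S (isTower_cons_pow hmG) hS

/-- **The one-support door decides the summit**: `HyperGPMatrixDescartes → PencilTransfer → TowerThetaWitness →
VP ≠ VNP` (same arithmetic as `closes`). -/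
theorem closes_hyperGP (hMDR : HyperGPMatrixDescartes) (hT : PencilTransfer) (hW : TowerThetaWitness) :
    _root_.ValiantsHypothesis := by
  show Literature.Computability.AlgebraicComplexity.VP ℂ ≠ Literature.Computability.AlgebraicComplexity.VNP ℂ
  intro hEq
  obtain ⟨Θ, hVNP, n₀, hroots⟩ := hW
  set d : (n : ℕ) → Fin n → ℕ := fun n i => (2 ^ n) ^ (i : ℕ) with hd
  have hVP : Literature.Computability.AlgebraicComplexity.IsVPFamily
      (fun n => MvPolynomial.map (algebraMap ℝ ℂ) (Θ n)) := by
    have hmem := (Literature.Computability.AlgebraicComplexity.mem_VNP_ofFintype_iff_holds _).2 hVNP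
    rw [← hEq] at hmem
    exact (Literature.Computability.AlgebraicComplexity.mem_VP_ofFintype_iff_holds _).1 hmem
  obtain ⟨c, hc⟩ := hT (fun n => n) Θ hVP d
  obtain ⟨K₀, hK⟩ := hMDR c 4 (by norm_num)
  obtain ⟨n, hn₀, hnK, hn4⟩ : ∃ n, n₀ ≤ n ∧ K₀ ≤ n ∧ 4 ≤ n := ⟨n₀ + K₀ + 4, by omega, by omega, by omega⟩
  obtain ⟨m, hm, S, hS, hroot⟩ := hc n
  set Z := (MvPolynomial.aeval (fun i => (Polynomial.X : Polynomial ℝ) ^ d n i) (Θ n)).roots.toFinset.card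
    with hZ
  have h1 := hK n m hnK hm S hS
  rw [hroot] at h1
  have h2 : 2 ^ (n * Nat.log 2 n) ≤ Z + 1 := hroots n hn₀
  set L := Nat.log 2 n with hL
  have hL2 : 2 ≤ L := by
    rw [hL]
    calc 2 = Nat.log 2 4 := by decide
      _ ≤ Nat.log 2 n := Nat.log_mono_right hn4
  have hLn : L ≤ n := by rw [hL]; exact Nat.log_le_self 2 n
  have hL' : Nat.log 2 (n + 1) ≤ L + 1 := by
    rw [hL]
    calc Nat.log 2 (n + 1) ≤ Nat.log 2 (n * 2) := Nat.log_mono_right (by omega)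
      _ = Nat.log 2 n + 1 := Nat.log_mul_base (by norm_num) (by omega)
  have h3 : Z ^ 4 ≤ 2 ^ ((n + 1) * (L + 1)) :=
    h1.trans (Nat.pow_le_pow_right (by norm_num) (Nat.mul_le_mul_left _ hL'))
  have hnL : 1 ≤ n * L := by nlinarith
  have h4 : 2 ^ (n * L - 1) ≤ Z := by
    have e : 2 ^ (n * L) = 2 * 2 ^ (n * L - 1) := by
      rw [← Nat.pow_succ']
      congr 1
      omega
    have h2' := h2
    rw [e] at h2'
    have : 1 ≤ 2 ^ (n * L - 1) := Nat.one_le_two_pow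
    omega
  have h5 : 2 ^ (4 * (n * L - 1)) ≤ Z ^ 4 := by
    rw [pow_mul']
    exact Nat.pow_le_pow_left h4 4
  have h6 : 4 * (n * L - 1) ≤ (n + 1) * (L + 1) :=
    (Nat.pow_le_pow_iff_right (by norm_num)).1 (h5.trans h3)
  have h7 : 6 * n ≤ 3 * (n * L) := by nlinarith
  have h6' : 4 * (n * L - 1) ≤ n * L + n + L + 1 := by
    have e : (n + 1) * (L + 1) = n * L + n + L + 1 := by ring
    rw [e] at h6
    exact h6
  generalize hP : n * L = P at h6' h7 hnL
  omega

/-- **Corollary (the re-glue)**: `TowerRealRootLaw → PencilTransfer → TowerThetaWitness → VP ≠ VNP`. -/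
theorem valiant_of_towerRealRootLaw (hB : TowerRealRootLaw) (hT : PencilTransfer) (hW : TowerThetaWitness) :
    _root_.ValiantsHypothesis :=
  closes_tower (towerMatrixDescartes_of_towerRealRootLaw hB) hT hW

/-- **LINE (B)'s head feeds the door**: `TowerB → TowerRealRootLaw` (reflection `X ↦ −X` keeps the support, hence
the tower property, and the letters symmetric: `card ≤ ζ₊(F) + ζ₊(F(−X)) + 1 ≤ 2^{(C+2)(K + log² m)}`, tree
`stub_negRoots`). -/
theorem towerRealRootLaw_of_towerB (h : TowerB) : TowerRealRootLaw := by
  obtain ⟨C, hC⟩ := h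
  refine ⟨C + 2, fun m K d S hd hS => ?_⟩
  rcases Nat.eq_zero_or_pos K with hK | hK
  · subst hK
    have h0 : (∑ l : Fin 0, (Polynomial.X : Polynomial ℝ) ^ d l • (S l).map Polynomial.C) = 0 := by simp
    rw [h0]
    rcases Nat.eq_zero_or_pos m with hm | hm
    · subst hm; simp [Matrix.det_isEmpty]
    · haveI : Nonempty (Fin m) := ⟨⟨0, hm⟩⟩
      simp [Matrix.det_zero]
  · have h1 := hC m K d hd S hS
    have h2 := hC m K d hd (fun l => ((-1 : ℝ) ^ d l) • S l) (fun l => (hS l).smul _)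
    have h3 := stub_negRoots K m d S
    set A := C * (K + Nat.log 2 m ^ 2) with hAdef
    have h4 : 2 ^ A + 2 ^ A + 1 ≤ 2 ^ ((C + 2) * (K + Nat.log 2 m ^ 2)) := by
      have h5 : (C + 2) * (K + Nat.log 2 m ^ 2) = A + 2 * (K + Nat.log 2 m ^ 2) := by rw [hAdef]; ring
      have h6 : 2 ≤ 2 * (K + Nat.log 2 m ^ 2) := by omega
      have h7 : 2 ^ 2 ≤ 2 ^ (2 * (K + Nat.log 2 m ^ 2)) := Nat.pow_le_pow_right two_pos h6
      have h8 : 1 ≤ 2 ^ A := Nat.one_le_two_pow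
      calc 2 ^ A + 2 ^ A + 1 ≤ 2 ^ A * 2 ^ 2 := by omega
        _ ≤ 2 ^ A * 2 ^ (2 * (K + Nat.log 2 m ^ 2)) := Nat.mul_le_mul_left _ h7
        _ = 2 ^ ((C + 2) * (K + Nat.log 2 m ^ 2)) := by rw [h5, pow_add]
    exact h3.trans ((Nat.add_le_add (Nat.add_le_add h1 h2) le_rfl).trans h4)

/-- **LINE (B)'s HEAD IS SUMMIT-DECIDING**: `TowerB → PencilTransfer → TowerThetaWitness → VP ≠ VNP`.  With the
tree's PROVED joints this is one application away from the registered stubs: `valiant_of_towerB (towerB_of_graftLaw hGL)`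
(S5, the graft law (GL)) and `valiant_of_towerB towerB_of_sizeDoublingPoly` (S4f + closed S4h) — both checked in this
seat's folder version of the file that imports `tower_graft` directly (`Sketch.lean`, rc 0; attached as item evidence). -/
theorem valiant_of_towerB (hB : TowerB) (hT : PencilTransfer) (hW : TowerThetaWitness) : _root_.ValiantsHypothesis :=
  valiant_of_towerRealRootLaw (towerRealRootLaw_of_towerB hB) hT hW

end Summit.ValiantsHypothesis.ValiantsHypothesis.Cruxes.MatrixDescartes.TowerDoorComplete

/-!
# Tower door — `TowerThetaWitness` PROVED: sub-sums of Tavenas' Hutchinson family along the tower curve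

`subV n I = Σ_{i < 2^n, i ∈ I} 2^{vExp n i} X^i` (the terms of `tavenasV n` indexed by `I`).  At Tavenas' points
`x_u = -4^{2u+1}/4^N` (`N = 2^n`), for `u ∈ I`, the `u`-th term still dominates (the tail bound of the tree's
`zSum_sign` is termwise, so dropping terms only helps): `sign subV(x_u) = (-1)^u`.  Hence along any strictly increasing
enumeration `k` of elements of `I` with `k u ≡ u (mod 2)` the signs alternate and `subV` has `≥ r - 1` distinct real
roots (`le_card_roots_subV`, via the tree's `le_card_roots_toFinset_of_alternating`).  val-idea-22 g7. [folklore]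
-/

open Finset Polynomial
open scoped BigOperators

namespace Summit.ValiantsHypothesis.ValiantsHypothesis.Cruxes.MatrixDescartes.TowerDoorComplete

open Literature.Computability.AlgebraicComplexity

/-- The sub-sum of Tavenas' `V_n` over the index set `I`. -/
noncomputable def subV (n : ℕ) (I : Finset ℕ) : Polynomial ℤ :=
  ∑ i ∈ range (2 ^ n), if i ∈ I then C ((2 : ℤ) ^ vExp n i) * X ^ i else 0

theorem map_subV (n : ℕ) (I : Finset ℕ) : (subV n I).map (Int.castRingHom ℝ) =
    ∑ i ∈ range (2 ^ n), if i ∈ I then C ((2 : ℝ) ^ vExp n i) * X ^ i else 0 := by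
  unfold subV
  rw [Polynomial.map_sum]
  refine Finset.sum_congr rfl fun i _ => ?_
  split_ifs
  · rw [Polynomial.map_mul, Polynomial.map_pow, map_X, map_C]
    simp
  · simp

/-- coefficients of `subV`. -/
theorem coeff_subV (n : ℕ) (I : Finset ℕ) (k : ℕ) :
    (subV n I).coeff k = if k < 2 ^ n ∧ k ∈ I then (2 : ℤ) ^ vExp n k else 0 := by
  unfold subV
  rw [finsetSum_coeff]
  have hterm : ∀ i, (if i ∈ I then C ((2 : ℤ) ^ vExp n i) * X ^ i else 0 : ℤ[X]).coeff k =
      if k = i ∧ i ∈ I then (2 : ℤ) ^ vExp n i else 0 := by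
    intro i
    by_cases hiI : i ∈ I
    · rw [if_pos hiI, Polynomial.coeff_C_mul_X_pow]
      by_cases hki : k = i
      · simp [hki, hiI]
      · simp [hki]
    · simp [hiI]
  simp_rw [hterm]
  by_cases hk : k < 2 ^ n
  · rw [Finset.sum_eq_single k]
    · by_cases hkI : k ∈ I
      · simp [hk, hkI]
      · simp [hkI]
    · intro i _ hik
      rw [if_neg]
      rintro ⟨rfl, _⟩
      exact hik rfl
    · intro hk'
      exact absurd (mem_range.2 hk) hk'
  · rw [if_neg (fun h => hk h.1)]
    refine Finset.sum_eq_zero fun i hi => ?_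
    rw [if_neg]
    rintro ⟨rfl, _⟩
    exact hk (mem_range.1 hi)

/-- The integer `Z_u^I = Σ_{i<N, i∈I} (-1)^i 4^{E_u - (i-u)²}`. -/
def zSumI (N u : ℕ) (I : Finset ℕ) : ℤ :=
  ∑ i ∈ range N, if i ∈ I then (-1) ^ i * 4 ^ (N * (N - 1) + u * u - sqd i u) else 0

/-- **The `u`-th term dominates any sub-sum containing it**: `0 < (-1)^u Z_u^I` for `u < N`, `u ∈ I`. -/
theorem zSumI_sign {N u : ℕ} {I : Finset ℕ} (hu : u < N) (huI : u ∈ I) : 0 < (-1) ^ u * zSumI N u I := by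
  set E : ℕ := N * (N - 1) + u * u with hE
  have h1N : 1 ≤ N := by omega
  have huE : u ≤ E := (Nat.le_mul_self u).trans (Nat.le_add_left _ _)
  have hNE : N - (u + 1) ≤ E := by
    have : N - (u + 1) ≤ N * (N - 1) := by
      calc N - (u + 1) ≤ N - 1 := by omega
        _ ≤ N * (N - 1) := Nat.le_mul_of_pos_left _ h1N
    exact this.trans (Nat.le_add_right _ _)
  set g : ℕ → ℤ := fun i => if i ∈ I then (-1) ^ (u + i) * 4 ^ (E - sqd i u) else 0 with hg
  have hsum : (-1) ^ u * zSumI N u I = ∑ i ∈ range N, g i := by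
    rw [zSumI, mul_sum]
    refine sum_congr rfl fun i _ => ?_
    simp only [hg]
    split_ifs
    · simp only [pow_add]; ring
    · simp
  have hsplit : ∑ i ∈ range N, g i = ∑ i ∈ Ico 0 u, g i + (g u + ∑ i ∈ Ico (u + 1) N, g i) := by
    rw [range_eq_Ico, ← sum_Ico_consecutive g (Nat.zero_le u) hu.le, sum_eq_sum_Ico_succ_bot hu]
  have hgu : g u = 4 ^ E := by
    simp only [hg, if_pos huI, sqd_self, Nat.sub_zero, ← two_mul, pow_mul, neg_one_sq, one_pow, one_mul]
  have hterm : ∀ i d, d ≤ sqd i u → -(4 : ℤ) ^ (E - d) ≤ g i := by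
    intro i d hd
    have h4 : (4 : ℤ) ^ (E - sqd i u) ≤ 4 ^ (E - d) :=
      pow_le_pow_right₀ (by norm_num) (Nat.sub_le_sub_left hd E)
    have h4' : (0 : ℤ) ≤ 4 ^ (E - sqd i u) := by positivity
    have h4'' : (0 : ℤ) ≤ 4 ^ (E - d) := by positivity
    simp only [hg]
    split_ifs
    · rcases neg_one_pow_eq_or ℤ (u + i) with h | h <;> rw [h] <;> linarith
    · linarith
  have hT₁ : -(∑ i ∈ Ico 0 u, (4 : ℤ) ^ (E - (u - i))) ≤ ∑ i ∈ Ico 0 u, g i := by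
    rw [← sum_neg_distrib]
    exact sum_le_sum fun i _ => hterm i _ (sub_le_sqd i u)
  have hT₂ : -(∑ i ∈ Ico (u + 1) N, (4 : ℤ) ^ (E - (i - u))) ≤ ∑ i ∈ Ico (u + 1) N, g i := by
    rw [← sum_neg_distrib]
    exact sum_le_sum fun i _ => hterm i _ (sub_le_sqd' i u)
  have hG₁ : 3 * ∑ i ∈ Ico 0 u, (4 : ℤ) ^ (E - (u - i)) + 4 ^ (E - u) = 4 ^ E := by
    rw [← three_mul_geom4_add huE, ← range_eq_Ico, ← sum_range_reflect _ u]
    congr 2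
    refine sum_congr rfl fun i hi => ?_
    have := mem_range.1 hi
    congr 2; omega
  have hG₂ : 3 * ∑ i ∈ Ico (u + 1) N, (4 : ℤ) ^ (E - (i - u)) + 4 ^ (E - (N - (u + 1))) = 4 ^ E := by
    rw [← three_mul_geom4_add hNE, sum_Ico_eq_sum_range]
    congr 2
    refine sum_congr rfl fun i _ => ?_
    congr 2; omega
  have hp₀ : (0 : ℤ) < 4 ^ E := by positivity
  have hp₁ : (0 : ℤ) < 4 ^ (E - u) := by positivity
  have hp₂ : (0 : ℤ) < 4 ^ (E - (N - (u + 1))) := by positivity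
  rw [hsum, hsplit, hgu]
  linarith

/-- **The exact evaluation**: `4^{N(N-1)} subV(x_u) = Z_u^I` for `u < N = 2^n`. -/
theorem pow_mul_eval_xPt_subV (n u : ℕ) (I : Finset ℕ) (hu : u < 2 ^ n) :
    (4 : ℝ) ^ (2 ^ n * (2 ^ n - 1)) * ((subV n I).map (Int.castRingHom ℝ)).eval (xPt (2 ^ n) u) =
      (zSumI (2 ^ n) u I : ℝ) := by
  set N : ℕ := 2 ^ n with hN
  rw [map_subV, eval_finset_sum, mul_sum, zSumI, Int.cast_sum]
  refine sum_congr rfl fun i hi => ?_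
  have hi' : i < N := mem_range.1 hi
  split_ifs with hiI
  · rw [eval_mul, eval_C, eval_pow, eval_X]
    push_cast
    have h2 : (2 : ℝ) ^ vExp n i = 4 ^ (i * (N - 1 - i)) := by
      rw [vExp, ← hN, pow_mul]; norm_num
    have key : (4 : ℝ) ^ (N * (N - 1)) * 4 ^ (i * (N - 1 - i)) * 4 ^ ((2 * u + 1) * i) =
        4 ^ (N * (N - 1) + u * u - sqd i u) * 4 ^ (N * i) := by
      rw [← pow_add, ← pow_add, ← pow_add, expo_identity hi' hu]
    have h4c : (4 : ℝ) ^ (N * i) ≠ 0 := by positivity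
    rw [h2, xPt, div_pow, neg_pow, ← pow_mul, ← pow_mul]
    have hre : (4 : ℝ) ^ (N * (N - 1)) * (4 ^ (i * (N - 1 - i)) * ((-1) ^ i * 4 ^ ((2 * u + 1) * i) / 4 ^ (N * i)))
        = (-1) ^ i * (4 ^ (N * (N - 1)) * 4 ^ (i * (N - 1 - i)) * 4 ^ ((2 * u + 1) * i)) / 4 ^ (N * i) := by
      ring
    rw [hre, key, ← mul_assoc, mul_div_cancel_right₀ _ h4c]
  · simp

/-- **Sign of the sub-sum at `x_u`**: `0 < (-1)^u subV(x_u)` for `u < 2^n`, `u ∈ I`. -/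
theorem sign_eval_xPt_subV (n u : ℕ) (I : Finset ℕ) (hu : u < 2 ^ n) (huI : u ∈ I) :
    0 < (-1 : ℝ) ^ u * ((subV n I).map (Int.castRingHom ℝ)).eval (xPt (2 ^ n) u) := by
  have h := zSumI_sign hu huI
  have h' : (0 : ℝ) < (((-1) ^ u * zSumI (2 ^ n) u I : ℤ) : ℝ) := by exact_mod_cast h
  rw [Int.cast_mul, Int.cast_pow, Int.cast_neg, Int.cast_one, ← pow_mul_eval_xPt_subV n u I hu,
    mul_left_comm] at h'
  exact (mul_pos_iff_of_pos_left (by positivity)).1 h'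

theorem map_subV_ne_zero (n : ℕ) (I : Finset ℕ) {u : ℕ} (hu : u < 2 ^ n) (huI : u ∈ I) :
    (subV n I).map (Int.castRingHom ℝ) ≠ 0 := by
  intro h
  have := sign_eval_xPt_subV n u I hu huI
  rw [h, eval_zero, mul_zero] at this
  exact lt_irrefl _ this

/-- `xPt N` is strictly decreasing. -/
theorem xPt_strictAnti (N : ℕ) : StrictAnti (xPt N) := strictAnti_nat_of_succ_lt (xPt_succ_lt N)

/-- **Root count for sub-sums**: if `k u < k (u+1)` for `u + 1 < r`, `k u ∈ I`, `k u < 2^n` and `k u ≡ u (mod 2)`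
for `u < r`, then `subV n I` has at least `r - 1` distinct real roots. -/
theorem le_card_roots_subV (n r : ℕ) (I : Finset ℕ) (k : ℕ → ℕ) (hk : ∀ u, u + 1 < r → k u < k (u + 1))
    (hkN : ∀ u, u < r → k u < 2 ^ n) (hkI : ∀ u, u < r → k u ∈ I) (hpar : ∀ u, u < r → k u % 2 = u % 2) :
    r - 1 ≤ ((subV n I).map (Int.castRingHom ℝ)).roots.toFinset.card := by
  rcases Nat.eq_zero_or_pos r with hr | hr
  · subst hr; simp
  · set k' : ℕ → ℕ := fun u => if u < r then k u else 2 ^ n + u with hk'def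
    have hk' : ∀ u, k' u < k' (u + 1) := by
      intro u
      simp only [hk'def]
      split_ifs with h1 h2 h2
      · exact hk u h2
      · exact (hkN u h1).trans_le (Nat.le_add_right _ _)
      · omega
      · omega
    have hk'mono : StrictMono k' := strictMono_nat_of_lt_succ hk'
    have hk'eq : ∀ u, u < r → k' u = k u := fun u hu => by simp only [hk'def, if_pos hu]
    refine le_card_roots_toFinset_of_alternating _ (map_subV_ne_zero n I (hkN 0 hr) (hkI 0 hr))
      (fun u => xPt (2 ^ n) (k' u)) (r - 1) (fun u => xPt_strictAnti _ (hk'mono (Nat.lt_succ_self u))) ?_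
    intro u hu
    have hu' : u < r := by omega
    rw [hk'eq u hu']
    have hs := sign_eval_xPt_subV n (k u) I (hkN u hu') (hkI u hu')
    have hpow : (-1 : ℝ) ^ k u = (-1) ^ u := by
      rw [neg_one_pow_eq_pow_mod_two (R := ℝ), hpar u hu', ← neg_one_pow_eq_pow_mod_two]
    rwa [hpow] at hs

/-! ## Stage 2 — the partial Kronecker substitution on Tavenas' explicit bit polynomial `hV`

`hV k ν = Σ_e xselV e · zselV (vExpBits e)` (tree, `TavenasVnWitness`).  Killing the `x`-variables outside a set `P`
of bit positions (`x_j ↦ [j ∈ P] x^{2^j}`, `z_i ↦ 2^{2^i}`) evaluates `hV` to the sub-sum `subV ν (goodIdx ν P)` over the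
numerals whose binary support lies in `P`. -/

open Literature.Computability.AlgebraicComplexity.TavenasVn
open Literature.Computability.AlgebraicComplexity.BoolGadgets (sum_boolVec_eq_sum_range ofBits_eq_sum)
open Literature.Computability.Complexity.ArithCkt (ofBits_bitsOf)

/-- base change of `hV`. -/
theorem map_hV {k k' : Type} [CommRing k] [CommRing k'] (f : k →+* k') (ν : ℕ) :
    MvPolynomial.map f (hV k ν) = hV k' ν := by
  unfold hV xselV zselV
  rw [map_sum]
  refine Finset.sum_congr rfl fun e _ => ?_
  rw [map_mul, map_prod, map_prod]
  congr 1
  · refine Finset.prod_congr rfl fun i _ => ?_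
    split_ifs <;> simp
  · refine Finset.prod_congr rfl fun i _ => ?_
    split_ifs <;> simp

/-- The partial Kronecker point: `x_j ↦ [j ∈ P] x^{2^j}`, `z_i ↦ 2^{2^i}`. -/
def FP (ν : ℕ) (P : Finset ℕ) (x : ℝ) : XZ ν → ℝ :=
  Sum.elim (fun j => if (j : ℕ) ∈ P then x ^ 2 ^ (j : ℕ) else 0) (fun i => (2 : ℝ) ^ 2 ^ (i : ℕ))

theorem eval_FP_xselV (ν : ℕ) (P : Finset ℕ) (x : ℝ) (e : Fin ν → Bool) :
    MvPolynomial.eval (FP ν P x) (xselV ℝ ν e) =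
      if (∀ i : Fin ν, e i = true → (i : ℕ) ∈ P) then x ^ Nat.ofBits e else 0 := by
  unfold xselV
  rw [map_prod]
  have h : ∀ i : Fin ν, MvPolynomial.eval (FP ν P x)
      (if e i then (MvPolynomial.X (Sum.inl (xIdx i)) : MvPolynomial (XZ ν) ℝ) else 1) =
      if e i then (if ((i : ℕ)) ∈ P then x ^ 2 ^ (i : ℕ) else 0) else 1 := by
    intro i
    cases hi : e i
    · simp
    · simp [FP, xIdx]
  simp only [h]
  split_ifs with hall
  · rw [ofBits_eq_sum, ← Finset.prod_pow_eq_pow_sum]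
    refine Finset.prod_congr rfl fun i _ => ?_
    cases hi : e i
    · simp
    · simp [hall i hi]
  · push_neg at hall
    obtain ⟨i, hi, hiP⟩ := hall
    exact Finset.prod_eq_zero (Finset.mem_univ i) (by simp [hi, hiP])

theorem eval_FP_zselV (ν : ℕ) (P : Finset ℕ) (x : ℝ) (c : Fin (R ν) → Bool) :
    MvPolynomial.eval (FP ν P x) (zselV ℝ ν c) = (2 : ℝ) ^ Nat.ofBits c := by
  unfold zselV
  rw [map_prod, ofBits_eq_sum, ← Finset.prod_pow_eq_pow_sum]
  refine Finset.prod_congr rfl fun l _ => ?_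
  cases hl : c l
  · simp
  · simp [FP]

/-- numerals `< 2^ν` whose binary support lies in `P`. -/
def goodIdx (ν : ℕ) (P : Finset ℕ) : Finset ℕ :=
  (range (2 ^ ν)).filter (fun i => ∀ t < ν, Nat.testBit i t = true → t ∈ P)

theorem mem_goodIdx {ν : ℕ} {P : Finset ℕ} {i : ℕ} :
    i ∈ goodIdx ν P ↔ i < 2 ^ ν ∧ ∀ t < ν, Nat.testBit i t = true → t ∈ P := by
  unfold goodIdx
  rw [mem_filter, mem_range]

theorem ofBits_mem_goodIdx (ν : ℕ) (P : Finset ℕ) (e : Fin ν → Bool) :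
    Nat.ofBits e ∈ goodIdx ν P ↔ ∀ i : Fin ν, e i = true → (i : ℕ) ∈ P := by
  rw [mem_goodIdx]
  constructor
  · rintro ⟨-, h⟩ i hi
    have h' := h i i.2
    rw [Nat.testBit_ofBits, dif_pos i.2] at h'
    exact h' hi
  · intro h
    refine ⟨Nat.ofBits_lt_two_pow e, fun t ht hbit => ?_⟩
    rw [Nat.testBit_ofBits, dif_pos ht] at hbit
    exact h ⟨t, ht⟩ hbit

/-- **The partial Kronecker identity**: `hV(FP) = subV ν (goodIdx ν P)` evaluated at `x`. -/
theorem eval_FP_hV (ν : ℕ) (P : Finset ℕ) (x : ℝ) :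
    MvPolynomial.eval (FP ν P x) (hV ℝ ν) = ((subV ν (goodIdx ν P)).map (Int.castRingHom ℝ)).eval x := by
  unfold hV
  rw [map_sum]
  have h1 : ∀ e : Fin ν → Bool, MvPolynomial.eval (FP ν P x) (xselV ℝ ν e * zselV ℝ ν (vExpBits ν (R ν) e)) =
      (if Nat.ofBits e ∈ goodIdx ν P then (2 : ℝ) ^ vExp ν (Nat.ofBits e) * x ^ Nat.ofBits e else 0) := by
    intro e
    rw [map_mul, eval_FP_xselV, eval_FP_zselV, vExpBits, ofBits_bitsOf, Nat.mod_eq_of_lt (vExp_lt_two_pow_R ν e)]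
    by_cases h : ∀ i : Fin ν, e i = true → (i : ℕ) ∈ P
    · rw [if_pos h, if_pos ((ofBits_mem_goodIdx ν P e).2 h), mul_comm]
    · rw [if_neg h, if_neg (fun h' => h ((ofBits_mem_goodIdx ν P e).1 h')), zero_mul]
  simp only [h1]
  rw [sum_boolVec_eq_sum_range (fun i => if i ∈ goodIdx ν P then (2 : ℝ) ^ vExp ν i * x ^ i else 0), map_subV,
    eval_finset_sum]
  refine Finset.sum_congr rfl fun i _ => ?_
  split_ifs
  · rw [eval_mul, eval_C, eval_pow, eval_X]
  · rw [eval_zero]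

/-! ## Stage 3 — the tower enumeration and the witness -/

open Summit.ValiantsHypothesis.ValiantsHypothesis.Theorems.SymmetroidDescartes (complexity_pow_le)

/-- digit-wise base change: the base-`B` digits of `u` (lowest `a` of them) read in base `G`. -/
def kd (B G : ℕ) : ℕ → ℕ → ℕ
  | 0, _ => 0
  | a + 1, u => u % B + G * kd B G a (u / B)

theorem kd_lt {B G : ℕ} (hBG : B ≤ G) (hB : 1 ≤ B) : ∀ a u, kd B G a u < G ^ a := by
  intro a
  induction a with
  | zero => intro u; simp [kd]
  | succ a ih =>
    intro u
    simp only [kd]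
    have h1 := ih (u / B)
    have h2 : u % B < B := Nat.mod_lt _ hB
    calc u % B + G * kd B G a (u / B) < G + G * kd B G a (u / B) := by omega
      _ = G * (kd B G a (u / B) + 1) := by ring
      _ ≤ G * G ^ a := Nat.mul_le_mul_left _ h1
      _ = G ^ (a + 1) := by ring

theorem kd_lt_kd {B G : ℕ} (hBG : B ≤ G) (hB : 1 ≤ B) :
    ∀ a u u', u < u' → u' < B ^ a → kd B G a u < kd B G a u' := by
  intro a
  induction a with
  | zero => intro u u' h h'; simp at h'; omega
  | succ a ih =>
    intro u u' huu' hu'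
    simp only [kd]
    have hdiv : u / B ≤ u' / B := Nat.div_le_div_right huu'.le
    rcases hdiv.eq_or_lt with heq | hlt
    · have h1 := Nat.div_add_mod u B
      have h2 := Nat.div_add_mod u' B
      rw [heq] at h1
      rw [heq]
      omega
    · have hu'B : u' / B < B ^ a := by
        rw [Nat.div_lt_iff_lt_mul hB]
        calc u' < B ^ (a + 1) := hu'
          _ = B ^ a * B := pow_succ _ _
      have h3 := ih _ _ hlt hu'B
      have hmod : u % B < B := Nat.mod_lt _ hB
      calc u % B + G * kd B G a (u / B) < B + G * kd B G a (u / B) := by omega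
        _ ≤ G * (kd B G a (u / B) + 1) := by nlinarith
        _ ≤ G * kd B G a (u' / B) := Nat.mul_le_mul_left _ h3
        _ ≤ u' % B + G * kd B G a (u' / B) := Nat.le_add_left _ _

theorem kd_mod_two {B G : ℕ} (hB : 2 ∣ B) (hG : 2 ∣ G) : ∀ a u, 1 ≤ a → kd B G a u % 2 = u % 2 := by
  intro a u ha
  obtain ⟨a, rfl⟩ : ∃ a', a = a' + 1 := ⟨a - 1, by omega⟩
  simp only [kd]
  obtain ⟨g, rfl⟩ := hG
  rw [mul_assoc, Nat.add_mul_mod_self_left, Nat.mod_mod_of_dvd _ hB]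

theorem kd_testBit (n L : ℕ) (hL : L ≤ n) :
    ∀ a u t, Nat.testBit (kd (2 ^ L) (2 ^ n) a u) t = true → t % n < L ∧ t / n < a := by
  intro a
  induction a with
  | zero => intro u t h; simp [kd] at h
  | succ a ih =>
    intro u t h
    simp only [kd] at h
    have hmodlt : u % 2 ^ L < 2 ^ n :=
      (Nat.mod_lt _ (by positivity)).trans_le (Nat.pow_le_pow_right (by norm_num) hL)
    rw [add_comm, Nat.testBit_two_pow_mul_add _ hmodlt t] at h
    split_ifs at h with ht
    · have htL : t < L := by
        by_contra hc
        push_neg at hc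
        rw [Nat.testBit_lt_two_pow ((Nat.mod_lt _ (by positivity)).trans_le
          (Nat.pow_le_pow_right (by norm_num) hc))] at h
        exact Bool.false_ne_true h
      exact ⟨by rw [Nat.mod_eq_of_lt ht]; exact htL, by rw [Nat.div_eq_of_lt ht]; exact Nat.succ_pos _⟩
    · push_neg at ht
      obtain ⟨h1, h2⟩ := ih _ _ h
      rcases Nat.eq_zero_or_pos n with hn | hn
      · subst hn; exact absurd h1 (by omega)
      · refine ⟨by rwa [Nat.mod_eq_sub_mod ht], ?_⟩
        rw [Nat.div_lt_iff_lt_mul hn] at h2 ⊢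
        have : t - n < a * n := h2
        calc t < a * n + n := by omega
          _ = (a + 1) * n := by ring

/-- the admissible bit positions `P_n = {t < n² : t mod n < ⌊log₂ n⌋}`. -/
def towerP (n : ℕ) : Finset ℕ := (range (n * n)).filter (fun t => t % n < Nat.log 2 n)

theorem kd_mem_goodIdx (n u : ℕ) :
    kd (2 ^ Nat.log 2 n) (2 ^ n) n u ∈ goodIdx (n * n) (towerP n) := by
  have hL : Nat.log 2 n ≤ n := Nat.log_le_self 2 n
  rw [mem_goodIdx]
  refine ⟨?_, fun t _ hbit => ?_⟩
  · have := kd_lt (Nat.pow_le_pow_right (by norm_num) hL) Nat.one_le_two_pow n u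
    rwa [← pow_mul] at this
  · obtain ⟨h1, h2⟩ := kd_testBit n (Nat.log 2 n) hL n u t hbit
    unfold towerP
    rw [mem_filter, mem_range]
    refine ⟨?_, h1⟩
    rcases Nat.eq_zero_or_pos n with hn | hn
    · subst hn; simp at h1
    · exact (Nat.div_lt_iff_lt_mul hn).1 h2

/-- **The tower substitution** `x_j ↦ y_{⌊j/n⌋}^{2^{j mod n}}` for `j mod n < ⌊log₂ n⌋` and `⌊j/n⌋ < n`, else `0`;
`z_i ↦ 2^{2^i}`. -/
noncomputable def gT (n : ℕ) : XZ (n * n) → MvPolynomial (Fin n) ℝ :=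
  Sum.elim (fun j => if h : (j : ℕ) % n < Nat.log 2 n ∧ (j : ℕ) / n < n then
      MvPolynomial.X (⟨(j : ℕ) / n, h.2⟩ : Fin n) ^ 2 ^ ((j : ℕ) % n) else 0)
    (fun i => MvPolynomial.C ((2 : ℝ) ^ 2 ^ (i : ℕ)))

theorem two_pow_mod_le (n : ℕ) (j : ℕ) (h : j % n < Nat.log 2 n) : 2 ^ (j % n) ≤ n := by
  rcases Nat.eq_zero_or_pos n with hn | hn
  · subst hn; simp at h
  · exact (Nat.pow_le_pow_right (by norm_num) h.le).trans (Nat.pow_log_le_self 2 hn.ne')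

theorem complexity_gT_le (n : ℕ) (v : XZ (n * n)) :
    complexity (MvPolynomial.map (algebraMap ℝ ℂ) (gT n v)) ≤ n := by
  rcases v with j | i
  · simp only [gT, Sum.elim_inl]
    split_ifs with hj
    · rw [map_pow, MvPolynomial.map_X]
      refine (complexity_pow_le _ _).trans ?_
      rw [complexity_X_holds, mul_zero, zero_add]
      exact two_pow_mod_le n j hj.1
    · rw [map_zero, ← MvPolynomial.C_0, complexity_C_holds]
      exact Nat.zero_le _
  · simp only [gT, Sum.elim_inr]
    rw [MvPolynomial.map_C, complexity_C_holds]
    exact Nat.zero_le _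

theorem totalDegree_gT_le (n : ℕ) (v : XZ (n * n)) :
    (MvPolynomial.map (algebraMap ℝ ℂ) (gT n v)).totalDegree ≤ n := by
  rcases v with j | i
  · simp only [gT, Sum.elim_inl]
    split_ifs with hj
    · rw [map_pow, MvPolynomial.map_X]
      refine (MvPolynomial.totalDegree_pow _ _).trans ?_
      rw [MvPolynomial.totalDegree_X, mul_one]
      exact two_pow_mod_le n j hj.1
    · rw [map_zero, MvPolynomial.totalDegree_zero]
      exact Nat.zero_le _
  · simp only [gT, Sum.elim_inr]
    rw [MvPolynomial.map_C, MvPolynomial.totalDegree_C]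
    exact Nat.zero_le _

/-- along the tower curve `y_a = x^{2^{n a}}` the substitution lands on the partial Kronecker point. -/
theorem eval_gT (n : ℕ) (x : ℝ) (v : XZ (n * n)) :
    MvPolynomial.eval (fun a : Fin n => x ^ 2 ^ (n * (a : ℕ))) (gT n v) = FP (n * n) (towerP n) x v := by
  rcases v with j | i
  · have key : ((j : ℕ) % n < Nat.log 2 n ∧ (j : ℕ) / n < n) ↔ ((j : ℕ) < n * n ∧ (j : ℕ) % n < Nat.log 2 n) := by
      rcases Nat.eq_zero_or_pos n with hn | hn
      · subst hn; simp
      · rw [Nat.div_lt_iff_lt_mul hn]; tauto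
    simp only [gT, FP, Sum.elim_inl, towerP, mem_filter, mem_range]
    by_cases hj : (j : ℕ) % n < Nat.log 2 n ∧ (j : ℕ) / n < n
    · rw [dif_pos hj, if_pos (key.1 hj), map_pow, MvPolynomial.eval_X, ← pow_mul, ← pow_add, Nat.div_add_mod]
    · rw [dif_neg hj, if_neg (fun h => hj (key.2 h)), map_zero]
  · simp only [gT, FP, Sum.elim_inr, MvPolynomial.eval_C]

open Summit.ValiantsHypothesis.ValiantsHypothesis.Theorems.LacunarySymmetroid
  (isVNPFamily_aeval_of_isPBounded isVNPFamily_map_of_isProjection_perPoly)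

/-- `hV ℚ ν` is a projection of a permanent of p-bounded size (Tavenas Cor. 3.37 with the explicit witness). -/
theorem exists_isProjection_hV : ∃ N : ℕ → ℕ, IsPBounded N ∧ ∀ ν, IsProjection (hV ℚ ν) (perPoly (Fin (N ν)) ℚ) := by
  have hchar : ringChar ℚ ≠ 2 := by rw [ringChar.eq_zero]; norm_num
  choose N hN hproj using fun ν => isProjection_boolSum_eval (BCS1997_thm_21_27_holds ℚ)
    (BCS1997_thm_21_29_holds ℚ) hchar (witnessFin ν)
  refine ⟨N, ?_, fun ν => ?_⟩
  · have c := fun m : ℕ => IsPBounded.const m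
    exact (IsPBounded.mul_holds (c 10) (IsPBounded.add_holds (IsPBounded.mul_holds (c 2) isPBounded_size_witnessFin)
      (c 2))).mono hN
  · rw [← boolSum_witnessFin]
    exact hproj ν

/-- **`TowerThetaWitness`** (the statement of `Cruxes/MatrixDescartes/TowerDoor.lean`, verbatim): a real family with `VNP`
complexification whose restriction to the TOWER curve `y_i = X^{(2^n)^i}` has `≥ 2^{n⌊log₂ n⌋} - 1` distinct real zeros,
eventually.  Witness: Tavenas' bit polynomial `hV` of `V_{n²}` under the tower substitution `gT n`; the restriction is the
sub-sum of `V_{n²}` over numerals with binary support in `P_n`, which keeps Hutchinson's dominant-term sign pattern. -/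
theorem towerThetaWitness_holds :
    ∃ Θ : ∀ n : ℕ, MvPolynomial (Fin n) ℝ,
      IsVNPFamily (fun n => MvPolynomial.map (algebraMap ℝ ℂ) (Θ n)) ∧
      ∃ n₀ : ℕ, ∀ n : ℕ, n₀ ≤ n → 2 ^ (n * Nat.log 2 n) ≤
        (MvPolynomial.aeval (fun i : Fin n => (Polynomial.X : Polynomial ℝ) ^ (2 ^ n) ^ (i : ℕ)) (Θ n)).roots.toFinset.card
          + 1 := by
  obtain ⟨N, hN, hproj⟩ := exists_isProjection_hV
  refine ⟨fun n => MvPolynomial.aeval (gT n) (MvPolynomial.map (algebraMap ℚ ℝ) (hV ℚ (n * n))), ?_, 2, fun n hn => ?_⟩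
  · /- VNP -/
    have hmap : ∀ n : ℕ, MvPolynomial.map (algebraMap ℝ ℂ)
        (MvPolynomial.aeval (gT n) (MvPolynomial.map (algebraMap ℚ ℝ) (hV ℚ (n * n)))) =
        MvPolynomial.aeval (fun v => MvPolynomial.map (algebraMap ℝ ℂ) (gT n v))
          (MvPolynomial.map (algebraMap ℚ ℂ) (hV ℚ (n * n))) := by
      intro n
      rw [MvPolynomial.aeval_eq_bind₁, MvPolynomial.aeval_eq_bind₁, MvPolynomial.map_bind₁, MvPolynomial.map_map]
      congr 2
    simp only [hmap]
    have hν : IsPBounded fun n : ℕ => n * n := IsPBounded.mul_holds IsPBounded.id IsPBounded.id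
    have hB : IsPBounded fun n => (n + 2 * (2 * (n * n) + 3)) * (n + 1) :=
      IsPBounded.mul_holds
        (IsPBounded.add_holds IsPBounded.id (IsPBounded.mul_holds (IsPBounded.const 2)
          (IsPBounded.add_holds (IsPBounded.mul_holds (IsPBounded.const 2) hν) (IsPBounded.const 3))))
        (IsPBounded.add_holds IsPBounded.id (IsPBounded.const 1))
    refine isVNPFamily_aeval_of_isPBounded (σ := fun n => XZ (n * n)) (τ := fun n => Fin n)
      (isVNPFamily_map_of_isProjection_perPoly (σ := fun n => XZ (n * n))
        (q := fun n => N (n * n)) (IsPBounded.comp_holds hN hν) ?_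
        (fun n => hV ℚ (n * n)) fun n => hproj (n * n))
      (fun n v => MvPolynomial.map (algebraMap ℝ ℂ) (gT n v)) hB
      (fun n => ?_) (fun n => ?_) (fun n v => ?_)
    · refine (IsPBounded.add_holds (IsPBounded.add_holds (IsPBounded.mul_holds (IsPBounded.const 2) hν)
        (IsPBounded.const 3)) (IsPBounded.add_holds (IsPBounded.mul_holds (IsPBounded.const 2) hν)
        (IsPBounded.const 3))).mono fun n => ?_
      rw [Fintype.card_sum, Fintype.card_fin]
    · rw [Fintype.card_fin]
      calc n ≤ n + 2 * (2 * (n * n) + 3) := Nat.le_add_right _ _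
        _ = (n + 2 * (2 * (n * n) + 3)) * 1 := (mul_one _).symm
        _ ≤ _ := Nat.mul_le_mul_left _ (by omega)
    · calc ∑ v, complexity (MvPolynomial.map (algebraMap ℝ ℂ) (gT n v))
          ≤ ∑ _v : XZ (n * n), n := Finset.sum_le_sum fun v _ => complexity_gT_le n v
        _ = (2 * (2 * (n * n) + 3)) * n := by
          rw [Finset.sum_const, Finset.card_univ, Fintype.card_sum, Fintype.card_fin, smul_eq_mul]
          ring
        _ ≤ (n + 2 * (2 * (n * n) + 3)) * (n + 1) := Nat.mul_le_mul (Nat.le_add_left _ _) (Nat.le_succ _)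
    · calc (MvPolynomial.map (algebraMap ℝ ℂ) (gT n v)).totalDegree ≤ n := totalDegree_gT_le n v
        _ ≤ n + 1 := Nat.le_succ _
        _ = 1 * (n + 1) := (one_mul _).symm
        _ ≤ (n + 2 * (2 * (n * n) + 3)) * (n + 1) := Nat.mul_le_mul_right _ (by omega)
  · /- roots along the tower curve -/
    set L := Nat.log 2 n with hLdef
    have hL1 : 1 ≤ L := Nat.log_pos one_lt_two hn
    have hLn : L ≤ n := Nat.log_le_self 2 n
    have hP : MvPolynomial.aeval (fun i : Fin n => (Polynomial.X : Polynomial ℝ) ^ (2 ^ n) ^ (i : ℕ))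
        (MvPolynomial.aeval (gT n) (MvPolynomial.map (algebraMap ℚ ℝ) (hV ℚ (n * n)))) =
        (subV (n * n) (goodIdx (n * n) (towerP n))).map (Int.castRingHom ℝ) := by
      apply Polynomial.funext
      intro x
      rw [← eval_FP_hV, ← map_hV (algebraMap ℚ ℝ) (n * n), ← Polynomial.coe_aeval_eq_eval,
        MvPolynomial.comp_aeval_apply, MvPolynomial.comp_aeval_apply, MvPolynomial.aeval_eq_eval]
      have hF : (fun v => MvPolynomial.aeval (fun i : Fin n => Polynomial.aeval x
            ((Polynomial.X : Polynomial ℝ) ^ (2 ^ n) ^ (i : ℕ))) (gT n v)) = FP (n * n) (towerP n) x := by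
        funext v
        rw [← eval_gT n x v, MvPolynomial.aeval_eq_eval]
        have hpt : (fun i : Fin n => Polynomial.aeval x ((Polynomial.X : Polynomial ℝ) ^ (2 ^ n) ^ (i : ℕ))) =
            fun a : Fin n => x ^ 2 ^ (n * (a : ℕ)) := by
          funext i
          simp only [map_pow, Polynomial.aeval_X, ← pow_mul]
        rw [hpt]
      rw [hF]
    rw [hP]
    -- the enumeration `u ↦ kd (2^L) (2^n) n u`, `u < 2^{nL} = (2^L)^n`
    have hBG : 2 ^ L ≤ 2 ^ n := Nat.pow_le_pow_right (by norm_num) hLn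
    have hB1 : 1 ≤ 2 ^ L := Nat.one_le_two_pow
    have hr : 2 ^ (n * L) = (2 ^ L) ^ n := by rw [← pow_mul, mul_comm]
    have h := le_card_roots_subV (n * n) (2 ^ (n * L)) (goodIdx (n * n) (towerP n)) (kd (2 ^ L) (2 ^ n) n)
      (fun u hu => kd_lt_kd hBG hB1 n u (u + 1) (Nat.lt_succ_self u) (by rwa [← hr]))
      (fun u _ => by have := kd_lt hBG hB1 n u; rwa [← pow_mul] at this)
      (fun u _ => kd_mem_goodIdx n u)
      (fun u _ => kd_mod_two (dvd_pow_self 2 (by omega)) (dvd_pow_self 2 (by omega)) n u (by omega))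
    have h1 : 1 ≤ 2 ^ (n * L) := Nat.one_le_two_pow
    omega

/-! ## Final joint — `TowerB → VP ≠ VNP` with the other two legs DISCHARGED

`TowerDoor.lean` proves `valiant_of_towerB : TowerB → PencilTransfer → TowerThetaWitness → VH`; above,
`towerThetaWitness_holds : TowerThetaWitness`; the tree proves `PencilTransfer` (`pencilTransfer_proof`, stmt-18051 CLOSED).
Hence the head `TowerB` of the registered LINE (B) `Cruxes/WeakLifting/Lines/tower_graft.lean` (Conjecture B on TOWER
supports, positive-root currency) implies the summit with no other open leg, and by tower_graft's PROVED joints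
(`towerB_of_graftLaw`, `towerB_of_sizeDoublingPoly`) each of S5 `TowerGraftLaw` / S4f `TowerSizeDoublingPoly` is
summit-deciding.  VP ≠ VNP is NOT proved: `TowerB` is open. -/

/-- the new item of the tower door, discharged. -/
theorem towerThetaWitness_proof : TowerThetaWitness := towerThetaWitness_holds

/-- **`TowerB → VP ≠ VNP`** (`PencilTransfer` and `TowerThetaWitness` discharged). -/
theorem valiant_of_towerB_alone (hB : TowerB) : _root_.ValiantsHypothesis :=
  valiant_of_towerB hB
    Summit.ValiantsHypothesis.ValiantsHypothesis.Theorems.LacunarySymmetroid.pencilTransfer_proof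
    towerThetaWitness_proof

/-- **`TowerRealRootLaw → VP ≠ VNP`** (all-real-roots currency of the tower door). -/
theorem valiant_of_towerRealRootLaw_alone (h : TowerRealRootLaw) : _root_.ValiantsHypothesis :=
  closes_tower (towerMatrixDescartes_of_towerRealRootLaw h)
    Summit.ValiantsHypothesis.ValiantsHypothesis.Theorems.LacunarySymmetroid.pencilTransfer_proof
    towerThetaWitness_proof

end Summit.ValiantsHypothesis.ValiantsHypothesis.Cruxes.MatrixDescartes.TowerDoorComplete
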